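import Mathlib
import Summits.MatrixMultiplication.MatrixMultiplication.Theses.AutomaticSTPPDesigns
import Summits.MatrixMultiplication.MatrixMultiplication.Theses.GroupTheoreticSTPP
import Summits.MatrixMultiplication.MatrixMultiplication.Theorems.AutomaticSTPPDesignsAutomaticPackingThesisNormalForm
import Summits.MatrixMultiplication.MatrixMultiplication.Theorems.AutomaticSTPPDesignsAutomaticPackingThesisCyclicCalibration080
import Literature.Computability.AlgebraicComplexity.PrattTrapezoidValProofs
import Literature.Computability.AlgebraicComplexity.GroupTheoreticMatMulThmBProofs

/-!
# `AutomaticPackingThesis` — the two-families bridge: CKSU Conj. 4.7 implies the cyclic crux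

Route `MatrixMultiplication/AutomaticSTPPDesigns`, crux `stmt-MatrixMultiplication-7356`
(`AutomaticPackingThesis`), line `Sketch`, lead c3. Support file (`--supports`): it does not close
the crux; it proves the registered stub `stub_twoFamiliesBridge` of the skeleton: the route item
`CPackingConstruction` of route `GroupTheoreticSTPP` (stmt-MatrixMultiplication-0595) —
Cohn–Kleinberg–Szegedy–Umans 2005, Conj. 4.7 ("two families": for every `δ > 0` and all large `n`
some finite abelian `H`, `|H| ≤ n^(2+δ)`, holds `n` pairs `(Aᵢ, Bᵢ)` with the simultaneous double
product property and `|Aᵢ||Bᵢ| ≥ n^(2-δ)`) — implies the cyclic crux `AutomaticPackingThesis`.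

* `anyModulusBeat_of_twoFamilies` — the quantitative core: under Conj. 4.7, for every `0 < ε ≤ 1`
  some STPP design in some `ℤ/N`, `N ≥ 2`, has `N < ∑ₓ (|Aₓ||Bₓ||Cₓ|)^(2/3+ε)`.  The proof IS the
  proof of Pratt 2024, Thm. 4.7 (tree: `pratt2024_thm47_aux`, every input proved there) with the
  endgame changed: Behrend corner-free index set `ι₀`, the CKSU STPP family in `H³` on a balanced
  sub-family of the pairs, the cyclic decomposition `H ≃ ∏ⱼ ℤ/mⱼ`, the modulus `N = (3^k |H|)^3`
  and the count of the cyclic factors `k` by the slice-rank bound (BCCGNSU 2017) — verbatim; then,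
  instead of bounding `Val(ℤ/N)`, the STPP family itself is moved into `ℤ/N` along the mixed-radix
  map (it reflects three-fold sums), keeping its `|ι₀|` blocks of mass `≥ n^(3(2-δ))`, and
  `log N ≤ (6 - 3δ + 3ε/2) log n + (3/4)(C - 2 log 2 - log 64)` loses against
  `log (|ι₀| n^(3(2-δ)(2/3+ε))) ≥ (6 - 3δ + 6ε - 3εδ) log n - 2 log 2 - log 64`.
* `stub_twoFamiliesBridge` — the registered stub, through the any-modulus normal form of the crux
  (`automaticPackingThesis_iff_anyModulus`): for `τ ≥ 4/5` the proved calibration rung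
  `cyclicBeat_anyModulus_of_ge080`, for `2/3 < τ < 4/5` the core with `ε = τ - 2/3`.

## References
* K. Pratt, *On generalized corners and matrix multiplication*, ITCS 2024, arXiv:2309.03878:
  Thm. 4.7 and its proof (p. 10), Conj. 2.5.
* H. Cohn, R. Kleinberg, B. Szegedy, C. Umans, FOCS 2005, arXiv:math/0511460: Conj. 4.7, §6.
* J. Blasiak, T. Church, H. Cohn, J. Grochow, E. Naslund, W. Sawin, C. Umans, Discrete Analysis
  2017:3, arXiv:1605.06702: Thm. A, Thm. 4.14 (the slice-rank input, proved in the tree).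
-/

-- single-conjunct summit: the mandated namespace repeats `MatrixMultiplication`.
set_option linter.dupNamespace false

noncomputable section

namespace Summit.MatrixMultiplication.MatrixMultiplication.Theorems

namespace AutomaticPackingThesis

open Finset Literature.Combinatorics.Additive Literature.Computability.AlgebraicComplexity
open Summit.MatrixMultiplication.MatrixMultiplication.Theses.AutomaticSTPPDesigns

/-- **CKSU Conj. 4.7 beats every cyclic packing exponent `> 2/3`** (quantitative core): the
two-families hypothesis (verbatim the body of `CPackingConstruction` = the hypothesis of the tree's
`pratt2024_thm47_aux`) gives, for every `0 < ε ≤ 1`, an STPP design in some `ℤ/N`, `N ≥ 2`, with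
`N < ∑ₓ (|Aₓ||Bₓ||Cₓ|)^(2/3+ε)` — Pratt's proof of Thm. 4.7 with the STPP family itself moved to
`ℤ/N`. [cite: Pratt2024, Thm. 4.7 (proof)] [cite: CohnKleinbergSzegedyUmans2005, Conj. 4.7] -/
theorem anyModulusBeat_of_twoFamilies
    (hTF : ∀ δ : ℝ, 0 < δ → ∀ n₀ : ℕ, ∃ n ≥ n₀, ∃ (H : Type) (_ : AddCommGroup H) (_ : Fintype H)
      (A B : Fin n → Finset H),
      (∀ i : Fin n, ∀ a ∈ A i, ∀ a' ∈ A i, ∀ b ∈ B i, ∀ b' ∈ B i,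
          (a - a') + (b - b') = 0 → a = a' ∧ b = b') ∧
      (∀ i j k : Fin n, ∀ a ∈ A i, ∀ a' ∈ A j, ∀ b ∈ B j, ∀ b' ∈ B k,
          (a - a') + (b - b') = 0 → i = k) ∧
      (Fintype.card H : ℝ) ≤ (n : ℝ) ^ (2 + δ) ∧
      ∀ i : Fin n, (n : ℝ) ^ (2 - δ) ≤ (((A i).card * (B i).card : ℕ) : ℝ))
    (ε : ℝ) (hε : 0 < ε) (hε1 : ε ≤ 1) :
    ∃ (N n : ℕ) (_ : 2 ≤ N) (A B C : Fin n → Finset (ZMod N)),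
      IsSTPP A B C ∧
        (N : ℝ) < ∑ i, (((A i).card * (B i).card * (C i).card : ℕ) : ℝ) ^ (2 / 3 + ε) := by
  classical
  /- ### constants -/
  set c3 : ℝ := Real.log 3 with hc3
  have hc3pos : 0 < c3 := Real.log_pos (by norm_num)
  set L : ℕ := ⌈Real.exp (12 * c3 / ε)⌉₊ + 2 with hL
  have hL2 : 2 ≤ L := by omega
  have hLpos : (0 : ℝ) < L := by exact_mod_cast (show 0 < L by omega)
  have hlogL : 12 * c3 / ε ≤ Real.log L := by
    have h1 : Real.exp (12 * c3 / ε) ≤ L := by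
      have h2 := Nat.le_ceil (Real.exp (12 * c3 / ε))
      have h3 : (⌈Real.exp (12 * c3 / ε)⌉₊ : ℝ) ≤ L := by rw [hL]; push_cast; linarith
      linarith
    have h4 := Real.log_le_log (Real.exp_pos _) h1
    rwa [Real.log_exp] at h4
  have hlogLpos : 0 < Real.log L := lt_of_lt_of_le (by positivity) hlogL
  choose θ hθpos hθ using Literature.Combinatorics.Additive.exists_theta
  have hne : (Icc 2 L).Nonempty := ⟨2, mem_Icc.2 ⟨le_rfl, hL2⟩⟩
  set Λ : ℝ := (Icc 2 L).inf' hne fun q => -Real.log (θ q) with hΛ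
  have hΛpos : 0 < Λ := by
    rw [hΛ, Finset.lt_inf'_iff]
    intro q hq
    have hq2 : 2 ≤ q := (mem_Icc.1 hq).1
    have := Real.log_neg (hθpos q) ((hθ q hq2).1)
    linarith
  have hΛle : ∀ q ∈ Icc 2 L, Λ ≤ -Real.log (θ q) := fun q hq =>
    Finset.inf'_le (fun q => -Real.log (θ q)) hq
  set c₀ : ℝ := Real.log 3 + 2 * Real.log 4 + 2 * Real.log 2 + Real.log 64 with hc₀
  have hlog2 : 0 ≤ Real.log 2 := Real.log_nonneg (by norm_num)
  have hlog4 : 0 ≤ Real.log 4 := Real.log_nonneg (by norm_num)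
  have hlog64 : 0 ≤ Real.log 64 := Real.log_nonneg (by norm_num)
  have hc₀nn : 0 ≤ c₀ := by rw [hc₀]; linarith
  set M : ℝ := 12 * L * c3 / Λ with hM
  have hMnn : 0 ≤ M := by positivity
  set δ : ℝ := ε / (M + 8) with hδ
  have hδpos : 0 < δ := by positivity
  have hδM : δ * (M + 8) = ε := by rw [hδ]; field_simp
  have hδle : δ ≤ ε / 8 := by
    rw [hδ]
    exact div_le_div_of_nonneg_left hε.le (by norm_num) (by linarith)
  have hδ1 : δ ≤ 1 := by linarith
  set C : ℝ := 4 / 3 * L * c3 * c₀ / Λ + 2 * Real.log 2 + Real.log 64 with hC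
  have hCnn : 0 ≤ C := by positivity
  obtain ⟨n₁, hn₁⟩ := exists_cornerFree_indexMaps_card_ge δ hδpos hδ1
  set n₂ : ℕ := ⌈Real.exp (C / ε)⌉₊ with hn₂
  /- ### the SDPP configuration -/
  obtain ⟨n, hn, H, _i1, _i2, A, B, hD, hSD, hcardH, hAB⟩ := hTF δ hδpos (2 * n₁ + n₂ + 16)
  have hnpos : (0 : ℝ) < n := by exact_mod_cast (show 0 < n by omega)
  have hn1 : (1 : ℝ) < n := by exact_mod_cast (show 1 < n by omega)
  set ℓn := Real.log n with hℓn
  have hℓnpos : 0 < ℓn := Real.log_pos hn1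
  have hCn : C ≤ ε * ℓn := by
    have h1 : Real.exp (C / ε) ≤ n := by
      have h2 := Nat.le_ceil (Real.exp (C / ε))
      have h3 : (⌈Real.exp (C / ε)⌉₊ : ℝ) ≤ n := by exact_mod_cast (show n₂ ≤ n by omega)
      linarith
    have h4 := Real.log_le_log (Real.exp_pos _) h1
    rw [Real.log_exp, div_le_iff₀ hε] at h4
    linarith
  set Y : ℝ := (n : ℝ) ^ (2 - δ) with hY
  have hYpos : 0 < Y := Real.rpow_pos_of_pos hnpos _
  have hlogY : Real.log Y = 2 * ℓn - δ * ℓn := by rw [hY, Real.log_rpow hnpos]; ring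
  have hAB' : ∀ i, Y ≤ ((#(A i) * #(B i) : ℕ) : ℝ) := hAB
  have hABpos : ∀ i, 0 < #(A i) * #(B i) := fun i => by
    have h := hYpos.trans_le (hAB' i)
    exact_mod_cast h
  have hAne : ∀ i, (A i).Nonempty := fun i => card_pos.1 (Nat.pos_of_mul_pos_right (hABpos i))
  have hBne : ∀ i, (B i).Nonempty := fun i => card_pos.1 (Nat.pos_of_mul_pos_left (hABpos i))
  have hHpos : (0 : ℝ) < Fintype.card H := by exact_mod_cast Fintype.card_pos
  set logH := Real.log (Fintype.card H) with hlogH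
  have hlogH_le : logH ≤ 2 * ℓn + δ * ℓn := by
    have h := Real.log_le_log hHpos hcardH
    rw [Real.log_rpow hnpos] at h
    linarith
  have i0 : Fin n := ⟨0, by omega⟩
  have hHge : Y ≤ Fintype.card H := by
    refine (hAB' i0).trans ?_
    have h : #(A i0) * #(B i0) ≤ Fintype.card H := by
      rw [← card_product]
      have hinj : Set.InjOn (fun p : H × H => p.1 + p.2) ↑(A i0 ×ˢ B i0) := by
        rintro ⟨a, b⟩ hab ⟨a', b'⟩ hab' (h : a + b = a' + b')
        simp only [coe_product, Set.mem_prod, mem_coe] at hab hab'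
        have h' : (a - a') + (b - b') = 0 := by
          have e1 : (a - a') + (b - b') = (a + b) - (a' + b') := by abel
          rw [e1, h, sub_self]
        obtain ⟨rfl, rfl⟩ := hD i0 a hab.1 a' hab'.1 b hab.2 b' hab'.2 h'
        rfl
      calc #(A i0 ×ˢ B i0) = #((A i0 ×ˢ B i0).image fun p : H × H => p.1 + p.2) :=
            (card_image_of_injOn hinj).symm
        _ ≤ Fintype.card H := card_le_univ _
    exact_mod_cast h
  have hδℓ : δ * ℓn ≤ ℓn := mul_le_of_le_one_left hℓnpos.le hδ1
  /- ### balanced sub-family -/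
  obtain ⟨good, hgood2, hgood⟩ := exists_balanced_indices (S := Fintype.card H)
    (fun i => #(A i)) (fun i => #(B i)) (sum_card_le_card_of_sdpp_left hSD hBne)
    (sum_card_le_card_of_sdpp_right hSD hAne)
  set n' := #good with hn'
  set g : Fin n' ↪o Fin n := good.orderEmbOfFin rfl with hg
  have hgmem : ∀ y, g y ∈ good := fun y => Finset.orderEmbOfFin_mem good rfl y
  have hn'ge : n₁ ≤ n' := by omega
  have hn'pos : (0 : ℝ) < n' := by exact_mod_cast (show 0 < n' by omega)
  /- ### corner-free indices and the STPP family in `H³` -/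
  obtain ⟨ι₀, _, _, j₁, j₂, j₃, hι₀, hcf⟩ := hn₁ n' hn'ge
  set i₁ : ι₀ → Fin n := fun x => g (j₁ x) with hi₁
  set i₂ : ι₀ → Fin n := fun x => g (j₂ x) with hi₂
  set i₃ : ι₀ → Fin n := fun x => g (j₃ x) with hi₃
  have hcf' : ∀ x y z : ι₀, i₁ x = i₁ z → i₂ y = i₂ x → i₃ z = i₃ y → x = y ∧ y = z :=
    fun x y z h1 h2 h3 => hcf x y z (g.injective h1) (g.injective h2) (g.injective h3)
  have hS := addSimultaneousTPP_of_sdpp hD hSD i₁ i₂ i₃ hcf'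
  have hι₀pos : 0 < Fintype.card ι₀ := by
    refine Nat.pos_of_ne_zero fun h0 => ?_
    rw [h0, Nat.cast_zero, mul_zero] at hι₀
    exact absurd hι₀ (not_le.2 (Real.rpow_pos_of_pos hn'pos _))
  have hι₀posR : (0 : ℝ) < Fintype.card ι₀ := by exact_mod_cast hι₀pos
  set logι := Real.log (Fintype.card ι₀) with hlogιdef
  have hlogι : 2 * ℓn - δ * ℓn - 2 * Real.log 2 + δ * Real.log 2 - Real.log 64 ≤ logι := by
    have h1 := Real.log_le_log (Real.rpow_pos_of_pos hn'pos _) hι₀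
    rw [Real.log_rpow hn'pos, Real.log_mul (by norm_num) hι₀posR.ne'] at h1
    have h2 : ℓn - Real.log 2 ≤ Real.log n' := by
      rw [hℓn, ← Real.log_div hnpos.ne' two_ne_zero]
      refine Real.log_le_log (by positivity) ?_
      rw [div_le_iff₀ two_pos]
      exact_mod_cast (show n ≤ n' * 2 by omega)
    have h3 : (2 - δ) * (ℓn - Real.log 2) ≤ (2 - δ) * Real.log n' :=
      mul_le_mul_of_nonneg_left h2 (by linarith)
    linarith
  /- ### the cyclic decomposition and the modulus `N` -/
  obtain ⟨k, m, hm2, ⟨e⟩, hprod, kL, r, hk, hLk, hhomo⟩ := exists_pi_zmod_decomp H L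
  have hprodpos : 0 < ∏ j, m j := Finset.prod_pos fun j _ => by have := hm2 j; omega
  set N : ℕ := (3 ^ k * ∏ j, m j) ^ 3 with hN
  have hNpos : 0 < N := pow_pos (Nat.mul_pos (pow_pos (by norm_num) k) hprodpos) 3
  have hN2 : 2 ≤ N := by
    have h1 : (n : ℝ) ≤ Y :=
      (Real.rpow_one _).symm.le.trans (Real.rpow_le_rpow_of_exponent_le hn1.le (by linarith))
    have h2 : n ≤ Fintype.card H := by exact_mod_cast (h1.trans hHge)
    have h3 : Fintype.card H ≤ N := by
      rw [hN, ← hprod]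
      calc ∏ j, m j ≤ 3 ^ k * ∏ j, m j := Nat.le_mul_of_pos_left _ (pow_pos (by norm_num) k)
        _ ≤ (3 ^ k * ∏ j, m j) ^ 3 := Nat.le_self_pow (by norm_num) _
    omega
  /- ### the slice-rank bound on each homocyclic component: `3 Λ r_q ≤ 9 δ log n + c₀` -/
  set Z : ℝ := 4 * Fintype.card H / n with hZdef
  have hZpos : 0 < Z := by positivity
  have hlogZ : Real.log Z = Real.log 4 + logH - ℓn := by
    rw [hZdef, Real.log_div (by positivity) hnpos.ne', Real.log_mul (by norm_num) hHpos.ne']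
  have hZ : ∀ x, (#(A (i₁ x)) : ℝ) ≤ Z ∧ (#(B (i₁ x)) : ℝ) ≤ Z ∧ (#(A (i₂ x)) : ℝ) ≤ Z ∧
      (#(B (i₂ x)) : ℝ) ≤ Z ∧ (#(A (i₃ x)) : ℝ) ≤ Z ∧ (#(B (i₃ x)) : ℝ) ≤ Z := by
    have key : ∀ i ∈ good, (#(A i) : ℝ) ≤ Z ∧ (#(B i) : ℝ) ≤ Z := by
      intro i hi
      obtain ⟨ha, hb⟩ := hgood i hi
      rw [hZdef, le_div_iff₀ hnpos, le_div_iff₀ hnpos]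
      exact ⟨by exact_mod_cast ha, by exact_mod_cast hb⟩
    intro x
    exact ⟨(key _ (hgmem _)).1, (key _ (hgmem _)).2, (key _ (hgmem _)).1, (key _ (hgmem _)).2,
      (key _ (hgmem _)).1, (key _ (hgmem _)).2⟩
  have hSdiv := card_mul_pow_div_le_sum_div_sdpp i₁ i₂ i₃ hYpos hAB' hZ
  push_cast at hSdiv
  have hlhs_pos : 0 < (Fintype.card ι₀ : ℝ) * Y ^ 3 / (3 * Z ^ 2) :=
    div_pos (mul_pos hι₀posR (pow_pos hYpos 3)) (by positivity)
  have hloglhs : Real.log ((Fintype.card ι₀ : ℝ) * Y ^ 3 / (3 * Z ^ 2)) =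
      logι + 3 * (2 * ℓn - δ * ℓn) - (Real.log 3 + 2 * (Real.log 4 + logH - ℓn)) := by
    rw [Real.log_div (mul_pos hι₀posR (pow_pos hYpos 3)).ne' (by positivity),
      Real.log_mul hι₀posR.ne' (pow_pos hYpos 3).ne', Real.log_pow, hlogY,
      Real.log_mul (by norm_num) (pow_pos hZpos 2).ne', Real.log_pow, hlogZ]
    push_cast
    ring
  have hr : ∀ q ∈ Icc 2 L, 3 * Λ * r q ≤ 9 * (δ * ℓn) + c₀ := by
    intro q hq
    rcases Nat.eq_zero_or_pos (r q) with h0 | hrpos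
    · rw [h0, Nat.cast_zero, mul_zero]
      positivity
    obtain ⟨p, hp, s, hqps, κ, _, _, G', _, _, _, hκ, ⟨e'⟩⟩ := hhomo q hq hrpos.ne'
    haveI : Fact p.Prime := ⟨hp⟩
    have hq2 : 2 ≤ q := (mem_Icc.1 hq).1
    haveI : NeZero q := ⟨by omega⟩
    obtain ⟨e3⟩ := nonempty_addEquiv_triple e'
    have hb := sum_card_div_le_of_addEquiv_piZMod hS (p := p) s hqps e3 (hθpos q) (hθ q hq2).2
    have hmain := hSdiv.trans hb
    rw [Fintype.card_sum, Fintype.card_sum, hκ, Fintype.card_prod, Fintype.card_prod] at hmain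
    have hθq1 : θ q < 1 := (hθ q hq2).1
    have hrhs : Real.log (θ q ^ (r q + (r q + r q)) *
        ((Fintype.card H * (Fintype.card H * Fintype.card H) : ℕ) : ℝ)) =
        3 * r q * Real.log (θ q) + 3 * logH := by
      have hH3 : ((Fintype.card H * (Fintype.card H * Fintype.card H) : ℕ) : ℝ) ≠ 0 := by
        exact_mod_cast (Nat.mul_pos Fintype.card_pos
          (Nat.mul_pos Fintype.card_pos Fintype.card_pos)).ne'
      rw [Real.log_mul (pow_pos (hθpos q) _).ne' hH3, Real.log_pow]
      push_cast
      rw [Real.log_mul hHpos.ne' (mul_pos hHpos hHpos).ne', Real.log_mul hHpos.ne' hHpos.ne']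
      ring
    have h1 := Real.log_le_log hlhs_pos hmain
    rw [hloglhs, hrhs] at h1
    have h2 : (r q : ℝ) * Λ ≤ (r q) * (-Real.log (θ q)) :=
      mul_le_mul_of_nonneg_left (hΛle q hq) (Nat.cast_nonneg _)
    rw [hc₀]
    linarith [h1, h2, hlogH_le, hlogι, hδℓ, hlog2, mul_nonneg hδpos.le hlog2]
  /- ### counting the cyclic factors -/
  have hsumr : 3 * Λ * ((∑ q ∈ Icc 2 L, r q : ℕ) : ℝ) ≤ L * (9 * (δ * ℓn) + c₀) := by
    push_cast
    rw [Finset.mul_sum]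
    calc ∑ q ∈ Icc 2 L, 3 * Λ * (r q : ℝ) ≤ ∑ _q ∈ Icc 2 L, (9 * (δ * ℓn) + c₀) :=
          sum_le_sum hr
      _ = (#(Icc 2 L) : ℝ) * (9 * (δ * ℓn) + c₀) := by rw [sum_const, nsmul_eq_mul]
      _ ≤ L * (9 * (δ * ℓn) + c₀) := by
          refine mul_le_mul_of_nonneg_right ?_ (by positivity)
          have : #(Icc 2 L) ≤ L := by rw [Nat.card_Icc]; omega
          exact_mod_cast this
  have hkL : (kL : ℝ) * Real.log L ≤ logH := by
    have h1 : ((L ^ kL : ℕ) : ℝ) ≤ Fintype.card H := by exact_mod_cast hLk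
    have h2 := Real.log_le_log (by exact_mod_cast pow_pos (show 0 < L by omega) kL) h1
    rwa [Nat.cast_pow, Real.log_pow] at h2
  have hNR : (N : ℝ) = ((3 : ℝ) ^ k * Fintype.card H) ^ 3 := by
    rw [hN, ← hprod]
    push_cast
    ring
  have hlogN : Real.log (N : ℝ) = 3 * (k * c3 + logH) := by
    rw [hNR, Real.log_pow, Real.log_mul (pow_pos (by norm_num) k).ne' hHpos.ne', Real.log_pow]
    push_cast
    ring
  have hkR : (k : ℝ) = kL + ((∑ q ∈ Icc 2 L, r q : ℕ) : ℝ) := by exact_mod_cast hk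
  have hkL' : 3 * c3 * kL ≤ 3 / 4 * (ε * ℓn) := by
    have h12 : 12 * c3 ≤ ε * Real.log L := by
      have := (div_le_iff₀ hε).1 hlogL
      linarith
    have hkL0 : (0 : ℝ) ≤ kL := Nat.cast_nonneg _
    have h1 : 12 * c3 * kL ≤ ε * Real.log L * kL := mul_le_mul_of_nonneg_right h12 hkL0
    have h2 : ε * Real.log L * kL ≤ ε * (3 * ℓn) := by
      rw [mul_assoc]
      refine mul_le_mul_of_nonneg_left ?_ hε.le
      calc Real.log L * kL = kL * Real.log L := mul_comm _ _
        _ ≤ logH := hkL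
        _ ≤ 2 * ℓn + δ * ℓn := hlogH_le
        _ ≤ 3 * ℓn := by linarith
    linarith
  have hsumr' : 3 * c3 * ((∑ q ∈ Icc 2 L, r q : ℕ) : ℝ) ≤
      3 / 4 * (M * (δ * ℓn)) + L * c3 * c₀ / Λ := by
    have h1 := mul_le_mul_of_nonneg_left hsumr (div_nonneg hc3pos.le hΛpos.le)
    have e1 : c3 / Λ * (3 * Λ * ((∑ q ∈ Icc 2 L, r q : ℕ) : ℝ)) =
        3 * c3 * ((∑ q ∈ Icc 2 L, r q : ℕ) : ℝ) := by field_simp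
    have e2 : c3 / Λ * (L * (9 * (δ * ℓn) + c₀)) = 3 / 4 * (M * (δ * ℓn)) + L * c3 * c₀ / Λ := by
      rw [hM]; field_simp; ring
    rwa [e1, e2] at h1
  have hMδ : M * (δ * ℓn) = ε * ℓn - 8 * (δ * ℓn) := by
    have : M * δ = ε - 8 * δ := by linarith [hδM]   -- from δ (M+8) = ε
    calc M * (δ * ℓn) = (M * δ) * ℓn := by ring
      _ = (ε - 8 * δ) * ℓn := by rw [this]
      _ = ε * ℓn - 8 * (δ * ℓn) := by ring
  have hCdef : L * c3 * c₀ / Λ = 3 / 4 * (C - 2 * Real.log 2 - Real.log 64) := by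
    rw [hC]; ring
  /- ### the transfer of the STPP family to `ℤ_N` -/
  obtain ⟨ψ, hψ1, hψ2⟩ := exists_freiman3_triple_of_addEquiv (fun j => by have := hm2 j; omega) e
  have hψN : ∀ a b c, ψ a + ψ b + ψ c < N := hψ1
  set φ : H × H × H → ZMod N := fun x => ((ψ x : ℕ) : ZMod N) with hφ
  have hφr : ∀ a b c a' b' c', φ a + φ b + φ c = φ a' + φ b' + φ c' →
      a + b + c = a' + b' + c' := by
    intro a b c a' b' c' h
    apply hψ2
    have h' : ((ψ a + ψ b + ψ c : ℕ) : ZMod N) = ((ψ a' + ψ b' + ψ c' : ℕ) : ZMod N) := by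
      push_cast; exact h
    rwa [ZMod.natCast_eq_natCast_iff', Nat.mod_eq_of_lt (hψN _ _ _),
      Nat.mod_eq_of_lt (hψN _ _ _)] at h'
  have hinj := injective_of_reflect φ hφr
  set A₃ : ι₀ → Finset (ZMod N) := fun x => (A (i₁ x) ×ˢ (({0} : Finset H) ×ˢ B (i₃ x))).image φ
    with hA₃
  set B₃ : ι₀ → Finset (ZMod N) := fun x => (B (i₁ x) ×ˢ (A (i₂ x) ×ˢ ({0} : Finset H))).image φ
    with hB₃
  set C₃ : ι₀ → Finset (ZMod N) := fun x => (({0} : Finset H) ×ˢ (B (i₂ x) ×ˢ A (i₃ x))).image φ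
    with hC₃
  have hS₃ : AddSimultaneousTPP A₃ B₃ C₃ := addSimultaneousTPP_image_of_reflect hS φ hφr
  set e₀ : Fin (Fintype.card ι₀) ≃ ι₀ := (Fintype.equivFin ι₀).symm with he₀
  refine ⟨N, Fintype.card ι₀, hN2, _, _, _,
    (isSTPP_iff_addSimultaneousTPP _ _ _).2 (hS₃.comp e₀.injective), ?_⟩
  have hmass : ∀ x, Y ^ 3 ≤ (((A₃ x).card * (B₃ x).card * (C₃ x).card : ℕ) : ℝ) := by
    intro x
    have hc : #(A₃ x) * #(B₃ x) * #(C₃ x) =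
        #(A (i₁ x)) * #(B (i₁ x)) * (#(A (i₂ x)) * #(B (i₂ x))) * (#(A (i₃ x)) * #(B (i₃ x))) := by
      simp only [hA₃, hB₃, hC₃, card_image_of_injective _ hinj]
      exact card_mul_card_mul_card_sdpp i₁ i₂ i₃ x
    have hc' : (((A₃ x).card * (B₃ x).card * (C₃ x).card : ℕ) : ℝ) =
        ((#(A (i₁ x)) * #(B (i₁ x)) : ℕ) : ℝ) * ((#(A (i₂ x)) * #(B (i₂ x)) : ℕ) : ℝ) *
          ((#(A (i₃ x)) * #(B (i₃ x)) : ℕ) : ℝ) := by exact_mod_cast hc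
    rw [hc', pow_three, ← mul_assoc]
    exact mul_le_mul (mul_le_mul (hAB' _) (hAB' _) hYpos.le (hYpos.le.trans (hAB' _))) (hAB' _)
      hYpos.le (mul_nonneg (hYpos.le.trans (hAB' _)) (hYpos.le.trans (hAB' _)))
  have hsum : (Fintype.card ι₀ : ℝ) * (Y ^ 3) ^ (2 / 3 + ε) ≤
      ∑ x, (((A₃ x).card * (B₃ x).card * (C₃ x).card : ℕ) : ℝ) ^ (2 / 3 + ε) := by
    rw [← nsmul_eq_mul, ← Finset.card_univ, ← Finset.sum_const]
    exact Finset.sum_le_sum fun x _ =>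
      Real.rpow_le_rpow (pow_pos hYpos 3).le (hmass x) (by linarith)
  /- ### conclusion: `log N < log (|ι₀| Y^(3(2/3+ε)))` -/
  have hRpos : (0 : ℝ) < Fintype.card ι₀ * (Y ^ 3) ^ (2 / 3 + ε) :=
    mul_pos hι₀posR (Real.rpow_pos_of_pos (pow_pos hYpos 3) _)
  have hCge : 2 * Real.log 2 + Real.log 64 ≤ C := by
    rw [hC]; linarith [show (0 : ℝ) ≤ 4 / 3 * L * c3 * c₀ / Λ by positivity]
  have hNlt : (N : ℝ) < Fintype.card ι₀ * (Y ^ 3) ^ (2 / 3 + ε) := by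
    rw [← Real.log_lt_log_iff (by exact_mod_cast hNpos) hRpos, hlogN,
      Real.log_mul hι₀posR.ne' (Real.rpow_pos_of_pos (pow_pos hYpos 3) _).ne',
      Real.log_rpow (pow_pos hYpos 3), Real.log_pow, hlogY]
    push_cast
    have hkc3 : (k : ℝ) * c3 = kL * c3 + ((∑ q ∈ Icc 2 L, r q : ℕ) : ℝ) * c3 := by rw [hkR]; ring
    linarith [hlogι, hkc3, hkL', hsumr', hMδ, hCdef, hCn, hCge, hlogH_le, mul_pos hε hℓnpos,
      mul_le_mul_of_nonneg_left hδℓ hε.le, mul_nonneg hδpos.le hlog2]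
  calc (N : ℝ) < Fintype.card ι₀ * (Y ^ 3) ^ (2 / 3 + ε) := hNlt
    _ ≤ ∑ x, (((A₃ x).card * (B₃ x).card * (C₃ x).card : ℕ) : ℝ) ^ (2 / 3 + ε) := hsum
    _ = ∑ i, (((A₃ (e₀ i)).card * (B₃ (e₀ i)).card * (C₃ (e₀ i)).card : ℕ) : ℝ) ^ (2 / 3 + ε) :=
        (e₀.sum_comp fun x => ((#(A₃ x) * #(B₃ x) * #(C₃ x) : ℕ) : ℝ) ^ (2 / 3 + ε)).symm

/-- Registered stub `stub_twoFamiliesBridge` of crux stmt-MatrixMultiplication-7356 (line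
`Sketch`): the route item `CPackingConstruction` of route `GroupTheoreticSTPP` (stmt-0595, CKSU
2005 Conj. 4.7 "two families") implies `AutomaticPackingThesis` — through
`automaticPackingThesis_iff_anyModulus`, by the rung `cyclicBeat_anyModulus_of_ge080` for
`τ ≥ 4/5` and by `anyModulusBeat_of_twoFamilies` with `ε = τ - 2/3` below `4/5`.
[cite: Pratt2024, Thm. 4.7 (proof)] [cite: CohnKleinbergSzegedyUmans2005, Conj. 4.7] -/
theorem stub_twoFamiliesBridge :
    Summit.MatrixMultiplication.MatrixMultiplication.Theses.GroupTheoreticSTPP.CPackingConstruction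
      → AutomaticPackingThesis := by
  intro hC
  rw [automaticPackingThesis_iff_anyModulus]
  intro τ hτ
  by_cases hτ' : (4 : ℝ) / 5 ≤ τ
  · exact cyclicBeat_anyModulus_of_ge080 τ hτ'
  · rw [show τ = 2 / 3 + (τ - 2 / 3) by ring]
    exact anyModulusBeat_of_twoFamilies hC (τ - 2 / 3) (by linarith) (by linarith [not_le.1 hτ'])

end AutomaticPackingThesis

end Summit.MatrixMultiplication.MatrixMultiplication.Theorems

end
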